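import Summits.ResolutionOfSingularities.ResolutionOfSingularities.Theorems.EquisingularLiftEquisingularLiftNatLargeCharSpreadDoor
import Literature.AlgebraicGeometry.Resolution.ProjectiveSpaceRegular
import Mathlib.AlgebraicGeometry.Morphisms.Smooth
import Mathlib.RingTheory.RingHom.Smooth
import HarnessLib

/-!
# EL♮(3) / EL♮(n), RUNG LC «large characteristic» — brick (B4)∘(B5): the point-wise door over every SMOOTH `ℤ`-ALGEBRA base inverting some `a ≠ 0`
# (the (B4) currency ✓ `LargeChar.exists_smooth_away_of_charZero`), from the K-side word

leafhand-res-equisingularlift-3 g0 (prover, 2026-08-31; one-generation line-first hand on stmt-ResolutionOfSingularities-20148 / -20038 /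
-15660, cell `pub/decomp-res`).  Crux `EquisingularLiftNatThree` (`stmt-…-20148`; uniform in `n`, so also `stmt-…-20038`), line W4.5(b), RUNG LC
(idea-2 g32 `Cruxes/EquisingularLiftNatThree/LARGE-CHAR-RUNG-idea2.md` v1.6 §(B4) «`B := A[1/(a a₀)]` is a smooth `ℤ`-algebra», §(B5)).  ✓
`exists_forall_descDoorAt_of_K_word` (…NatLargeCharSpreadDoor) delivers the door over every Noetherian flat `A`-algebra `B ∋ a⁻¹` with `Spec B` REGULAR; the
(B4) brick ✓ `LargeChar.exists_smooth_away_of_charZero` (…NatLargeCharSmoothBase) delivers SMOOTH `ℤ`-algebras.  This file closes the currency gap,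
DEF-FREE:

* `isRegular_Spec_of_smooth_int` — **a smooth `ℤ`-algebra has regular spectrum** (`Spec B → Spec ℤ` smooth, Mathlib `HasRingHomProperty.Spec_iff` +
  `RingHom.smooth_algebraMap`; `Spec ℤ` regular — Mathlib: Dedekind ⇒ `IsRegularRing`, ✓ `Scheme.isRegular_Spec`; ✓ `Scheme.IsRegular.of_smooth`);
* ★★★ `exists_forall_descDoorAt_of_K_word_smooth` — ✓ `exists_forall_descDoorAt_of_K_word` with the hypothesis «`Spec B` regular» replaced by
  «`B` a smooth `ℤ`-algebra» (any `Algebra ℤ B` instance — there is only one).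

HONEST RESIDUAL of `hspread` (unchanged otherwise): K-side inputs for the universal hypersurface (reduced generic equation + geometric-integrality
dichotomy + ✓ `LargeChar.exists_centreSeq_descTransformOK`), the choice `B := (A[1/a])[1/a₀]` with (B4) and the `A`-algebra/tower bookkeeping, ✓
`descDoorAt_of_ringHom`, the N:=1 glue `DescDoorAt ⇒ DescDoorSharp` (lh2), the (c3) tying, the binder bookkeeping of `hspread`.  EL♮(3) NOT proved; EL♮ NOT
proved; resolution of singularities in positive characteristic NOT proved; nothing of [Hironaka2017] (a candidate under adjudication) is asserted or used.
[OURS · bookkeeping · standard axioms · DEF-FREE · `--supports stmt-ResolutionOfSingularities-20148 --as helper`, counted 0 · AI-written, weaker than expert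
review.] [cite: GortzWedhorn2020, Lemma 6.26] [cite: StacksProject, Tag 02IS] (method; index only)
-/

set_option linter.dupNamespace false -- mandated namespace `Summit.<Summit>.<Problem>` of this single-conjunct summit

noncomputable section

open CategoryTheory CategoryTheory.Limits AlgebraicGeometry TopologicalSpace Topology
open MvPolynomial
open Literature.AlgebraicGeometry.Resolution
open Literature.AlgebraicGeometry.Motives
open AlgebraicGeometry.Scheme.IdealSheafData

namespace Summit.ResolutionOfSingularities.ResolutionOfSingularities.Cruxes.EquisingularLiftNat.Sections

section SmoothBase

/-- **A smooth `ℤ`-algebra has regular spectrum**: `Spec B → Spec ℤ` is smooth (Mathlib `RingHom.smooth_algebraMap`, `HasRingHomProperty.Spec_iff`) and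
`Spec ℤ` is regular (`ℤ` Dedekind ⇒ `IsRegularRing ℤ`, ✓ `Scheme.isRegular_Spec`), so ✓ `Scheme.IsRegular.of_smooth` applies.
[cite: GortzWedhorn2020, Lemma 6.26] [cite: StacksProject, Tag 02IS] [folklore] -/
theorem isRegular_Spec_of_smooth_int (B : Type) [CommRing B] [Algebra ℤ B] [Algebra.Smooth ℤ B] : Scheme.IsRegular (Spec (.of B)) := by
  have hsm : Smooth (Spec.map (CommRingCat.ofHom (algebraMap ℤ B))) :=
    (HasRingHomProperty.Spec_iff (P := @Smooth)).mpr (RingHom.smooth_algebraMap.mpr ‹_›)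
  haveI := hsm
  haveI : IsRegularRing (CommRingCat.of ℤ) := inferInstanceAs (IsRegularRing ℤ)
  exact Scheme.IsRegular.of_smooth (Spec.map (CommRingCat.ofHom (algebraMap ℤ B))) (Scheme.isRegular_Spec (.of ℤ))

variable (A : Type) [CommRing A] [IsDomain A] [IsNoetherianRing A] (K : Type) [Field K] [CharZero K] [Algebra A K] [IsFractionRing A K] (n : ℕ)

/-- ★★★ **The point-wise door over every SMOOTH `ℤ`-algebra base inverting some `a ≠ 0`** — ✓ `exists_forall_descDoorAt_of_K_word` with «`Spec B` regular»
replaced by «`B` smooth over `ℤ`» (`isRegular_Spec_of_smooth_int`), the currency of the (B4) brick ✓ `LargeChar.exists_smooth_away_of_charZero`.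
[cite: Grothendieck1966, EGA IV₃ §8–§9] [OURS · L1 W4.5b · RUNG LC (B4)∘(B5); EL♮(3) NOT proved] -/
theorem exists_forall_descDoorAt_of_K_word_smooth
    (tK : letI := MvPolynomial.gradedAlgebra (σ := Fin (n + 1)) (R := K)
      CentreSeq (Proj (homogeneousSubmodule (Fin (n + 1)) K)))
    (T : letI := MvPolynomial.gradedAlgebra (σ := Fin (n + 1)) (R := A)
      (Proj (homogeneousSubmodule (Fin (n + 1)) A)).IdealSheafData)
    {PK : Scheme.{0}}
    (σK : letI := MvPolynomial.gradedAlgebra (σ := Fin (n + 1)) (R := K)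
      Proj (homogeneousSubmodule (Fin (n + 1)) K) ⟶ PK) (Y₀K : Set PK)
    (hsmK : letI := MvPolynomial.gradedAlgebra (σ := Fin (n + 1)) (R := K)
      DescCentresSmoothOver tK
        (Proj.toSpecZero (homogeneousSubmodule (Fin (n + 1)) K) ≫
          Spec.map (CommRingCat.ofHom (algebraMap K (homogeneousSubmodule (Fin (n + 1)) K 0)))))
    (hTK : letI := MvPolynomial.gradedAlgebra (σ := Fin (n + 1)) (R := A)
      letI := MvPolynomial.gradedAlgebra (σ := Fin (n + 1)) (R := K)
      DescTransformOK tK σK Y₀K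
        (((T.comap (Proj.map (ProjBaseChangeRing.mapGraded A K (Fin (n + 1))) (ProjBaseChangeRing.irrelevant_le_map A K (Fin (n + 1))))).support :
          Set (Proj (homogeneousSubmodule (Fin (n + 1)) K)))))
    (hint : letI := MvPolynomial.gradedAlgebra (σ := Fin (n + 1)) (R := A)
      letI := MvPolynomial.gradedAlgebra (σ := Fin (n + 1)) (R := K)
      IsIntegral (T.comap (Proj.map (ProjBaseChangeRing.mapGraded A K (Fin (n + 1))) (ProjBaseChangeRing.irrelevant_le_map A K (Fin (n + 1))))).subscheme)
    (hGEN : letI := MvPolynomial.gradedAlgebra (σ := Fin (n + 1)) (R := A)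
      letI := MvPolynomial.gradedAlgebra (σ := Fin (n + 1)) (R := K)
      ∀ y, IsGenericPoint y
        (((T.comap (Proj.map (ProjBaseChangeRing.mapGraded A K (Fin (n + 1))) (ProjBaseChangeRing.irrelevant_le_map A K (Fin (n + 1))))).support :
          Set (Proj (homogeneousSubmodule (Fin (n + 1)) K)))) → IsGenericPoint (σK y) Y₀K) :
    letI := MvPolynomial.gradedAlgebra (σ := Fin (n + 1)) (R := A)
    letI := MvPolynomial.gradedAlgebra (σ := Fin (n + 1)) (R := K)
    ∃ (s : CentreSeq (Proj (homogeneousSubmodule (Fin (n + 1)) A))) (a : A),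
      s.comap (Proj.map (ProjBaseChangeRing.mapGraded A K (Fin (n + 1))) (ProjBaseChangeRing.irrelevant_le_map A K (Fin (n + 1)))) = tK ∧
      a ≠ 0 ∧
      ∀ (B : Type) [CommRing B] [IsNoetherianRing B] [Algebra A B] [Module.Flat A B] [Algebra ℤ B] [Algebra.Smooth ℤ B],
        IsUnit (algebraMap A B a) →
        ∀ (k : Type) [Field k] (θ : B →+* k) (H : Scheme.{0}) (ι : H ⟶ (Literature.AlgebraicGeometry.Motives.projectiveSpace n k).left),
          letI := MvPolynomial.gradedAlgebra (σ := Fin (n + 1)) (R := B)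
          letI := MvPolynomial.gradedAlgebra (σ := Fin (n + 1)) (R := k)
          (∀ (φ : homogeneousSubmodule (Fin (n + 1)) B →+*ᵍ homogeneousSubmodule (Fin (n + 1)) k)
              (hφ' : HomogeneousIdeal.irrelevant (homogeneousSubmodule (Fin (n + 1)) k) ≤
                (HomogeneousIdeal.irrelevant (homogeneousSubmodule (Fin (n + 1)) B)).map φ),
              (∀ t, φ t = MvPolynomial.map θ t) →
              IsPullback (Proj.map φ hφ' :
                    (Literature.AlgebraicGeometry.Motives.projectiveSpace n k).left ⟶ Proj (homogeneousSubmodule (Fin (n + 1)) B))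
                  (Proj.toSpecZero (homogeneousSubmodule (Fin (n + 1)) k) ≫
                    Spec.map (CommRingCat.ofHom (algebraMap k (homogeneousSubmodule (Fin (n + 1)) k 0))))
                  (Proj.toSpecZero (homogeneousSubmodule (Fin (n + 1)) B) ≫
                    Spec.map (CommRingCat.ofHom (algebraMap B (homogeneousSubmodule (Fin (n + 1)) B 0))))
                  (Spec.map (CommRingCat.ofHom θ)) →
              Set.range ι =
                (((T.comap (Proj.map (ProjBaseChangeRing.mapGraded A B (Fin (n + 1))) (ProjBaseChangeRing.irrelevant_le_map A B (Fin (n + 1))))).comap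
                    (Proj.map φ hφ' : (Literature.AlgebraicGeometry.Motives.projectiveSpace n k).left ⟶ Proj (homogeneousSubmodule (Fin (n + 1)) B))).support :
                  Set (Proj (homogeneousSubmodule (Fin (n + 1)) k)))) →
          DescDoorAt B k θ n H ι := by
  obtain ⟨s, a, hs, ha, h⟩ := exists_forall_descDoorAt_of_K_word A K n tK T σK Y₀K hsmK hTK hint hGEN
  refine ⟨s, a, hs, ha, fun B _ _ _ _ _ _ hunit k _ θ H ι htie => ?_⟩
  exact h B hunit (isRegular_Spec_of_smooth_int B) k θ H ι htie

end SmoothBase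

end Summit.ResolutionOfSingularities.ResolutionOfSingularities.Cruxes.EquisingularLiftNat.Sections

end
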